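import Mathlib.Tactic
import HarnessLib

/-!
# Kozma–Nitzan's Question 8 — the nested uniform form for A-perfect prefixes of any length (gen 35)

Support file (`--supports stmt-CriticalPhenomena-4575`, closed crux; independent mathematics on Kozma–Nitzan's Question 8,
arXiv:2401.12397 §5.5 p. 36), prover `prim-ineq-gen-6` (gen 35).  No definitions, no named facts, no sorries; standard axioms.
Memo `run/shared/lean/prim/prim-ineq-gen-6/PROOF-UNIFGFLAT-G35.md` §7.

With the flat reduction (…KnQuestion8UnifFlat.lean) the nested uniform form `UNIF-G′(i)` is equivalent to a pure prefix
statement `PRE_i − CR_i ≤ c_deep(λ_i)·BUD_i`.  For a prefix `b₁…b_i` WITHOUT A-defects (arbitrary C-defects and edge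
weights) this holds for every `i` with an `i`-independent argument: the exact telescoping
`PRE_i − CR_i = Σ_j [κ_{j−1}DEF_j − SL_j]` over the prefix vertices, the `a = 0` specialisation of gen 34's one-step pieces
(`kAP_E0`: the root sees the sub-root fuel at rate `λ′/λ` minus the C-defect tax; `kAP_vfree`: the v-observer is paid by its own
kill; `kAP_tauc`, `kAP_level`: the C-lens costs at most `(1−λ)λ′·c·Q ≤ ¼·c·Q`), and the FUEL IDENTITY `kAP_star_step`
(`B̃_{j−1} = (C_j/A_j)B̃_j − c_jQ_j + a_jP_j`, exact), whose telescoped form for `a = 0`, `Σ_j κ_{j−1}c_jQ_j = κ_iB̃_i − B̃₀`,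
says that the prefix C-defects consume at most the sub-root fuel.  Hence `PRE_i − CR_i ≤ ¼κ_iB̃_i ≤ c_deep(λ_i)BUD_i`
(`kAP_cdeep13a/b`: `c_deep(l) ≥ (1+l)/3`; `kAP_final`), i.e. (memo) `UNIF-G′(i)` for every `i` and every block whose prefix is
A-perfect.  Exact link checks: lab-g35/h35d_aperfect.py (410 NET(i) blocks, i ≤ 4, 719 levels, 0 failures).
[cite: KozmaNitzan2024, Question 8 (§5.5 p. 36)]
-/

namespace Summit.CriticalPhenomena.PercolationContinuityZ3.Theorems

namespace PocketCert

/-- **E0 with `a = 0`.**  For an A-perfect vertex `b_j = (1, C)`, `C = 1 − c`, edge weight `s`, parameter `L` (the λ of the block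
rooted at `b_{j−1}`): `u₁ = C·s·u`, `p₀ = p − s·c·u`, `T = 1 − p₀`, `T̃ = 1 − p`, `B̃ = L s u − T̃`, `λ′ = L − c(1+L)`.  Then the
root's net fuel is `L·u₁ − T = (λ′/L)·B̃ − T̃·c·(1+L)/L`.
[cite: KozmaNitzan2024, Question 8 (§5.5 p. 36)] -/
theorem kAP_E0 (L c s u p u₁ p₀ T Tt Bt lamp : ℝ) (hL : L ≠ 0) (hu1 : u₁ = (1 - c) * s * u)
    (hp0 : p₀ = p - s * c * u) (hT : T = 1 - p₀) (hTt : Tt = 1 - p) (hBt : Bt = L * s * u - Tt)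
    (hlamp : lamp = L - c * (1 + L)) :
    L * u₁ - T = lamp / L * Bt - Tt * c * (1 + L) / L := by
  subst hu1 hp0 hT hTt hBt hlamp
  field_simp
  ring

/-- **The v-observer is free when `a = 0`.**  `V1 = (1−L)(s v/p₀)(λ′/L)B̃ ≤ K1 = C(1−L)s(v/p)B̃`, because
`λ′·p ≤ L·C·p₀` reduces to `L·C·s·u ≤ p` (`u ≤ p`, `L, C, s ≤ 1`).
[cite: KozmaNitzan2024, Question 8 (§5.5 p. 36)] -/
theorem kAP_vfree (L c s u v p p₀ Bt : ℝ) (hL0 : 0 < L) (hL1 : L ≤ 1) (hc0 : 0 ≤ c) (hc1 : c ≤ 1) (hs0 : 0 ≤ s)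
    (hs1 : s ≤ 1) (hu0 : 0 ≤ u) (hup : u ≤ p) (hv : 0 ≤ v) (hp : 0 < p) (hp0 : p₀ = p - s * c * u) (hp0pos : 0 < p₀)
    (hBt : 0 ≤ Bt) :
    (1 - L) * (s * v / p₀) * ((L - c * (1 + L)) / L) * Bt ≤ (1 - c) * (1 - L) * s * (v / p) * Bt := by
  -- key: (L - c(1+L)) p ≤ L (1-c) p₀
  have key : (L - c * (1 + L)) * p ≤ L * (1 - c) * p₀ := by
    rw [hp0]
    have h1 : L * (1 - c) * s * u ≤ p := by
      have a1 : L * (1 - c) * s * u ≤ 1 * 1 * 1 * u := by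
        have : 0 ≤ 1 - c := by linarith
        have e1 : L * (1 - c) * s ≤ 1 := by
          calc L * (1 - c) * s ≤ 1 * 1 * 1 := by
                apply mul_le_mul (mul_le_mul hL1 (by linarith) this (by linarith)) hs1 hs0 (by positivity)
            _ = 1 := by ring
        nlinarith
      linarith
    nlinarith
  have e : (1 - L) * (s * v / p₀) * ((L - c * (1 + L)) / L) * Bt
      = ((L - c * (1 + L)) * p) * ((1 - L) * s * v * Bt / (p₀ * L * p)) := by
    field_simp
  have e2 : (1 - c) * (1 - L) * s * (v / p) * Bt = (L * (1 - c) * p₀) * ((1 - L) * s * v * Bt / (p₀ * L * p)) := by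
    field_simp
  rw [e, e2]
  have hk : 0 ≤ (1 - L) * s * v * Bt / (p₀ * L * p) := by
    have : 0 ≤ 1 - L := by linarith
    positivity
  exact mul_le_mul_of_nonneg_right key hk

/-- **The C-lens piece (`a = 0`)**: `τ_c = (1−L)(c m̃/p₀)·N ≤ C1 := (1−L)(c m̃/p₀)(λ′/L)B̃` since `N = (λ′/L)B̃ − T̃c(1+L)/L`.
[cite: KozmaNitzan2024, Question 8 (§5.5 p. 36)] -/
theorem kAP_tauc (L c mt p₀ N Bt Tt lamp : ℝ) (hL : 0 < L) (hc : 0 ≤ c) (hmt : 0 ≤ mt) (hp0 : 0 < p₀) (hL1 : L ≤ 1)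
    (hTt : 0 ≤ Tt) (hN : N = lamp / L * Bt - Tt * c * (1 + L) / L) :
    (1 - L) * (c * mt / p₀) * N ≤ (1 - L) * (c * mt / p₀) * (lamp / L * Bt) := by
  have hk : 0 ≤ (1 - L) * (c * mt / p₀) := by
    have : 0 ≤ 1 - L := by linarith
    positivity
  apply mul_le_mul_of_nonneg_left _ hk
  rw [hN]
  have : 0 ≤ Tt * c * (1 + L) / L := by positivity
  linarith

/-- **Per-level bound.**  `κ·C1 = κ(1−L)(cλ′/L)(m̃/p₀)B̃ ≤ ¼·κ·c·Q` from `m̃ ≤ p₀`, `B̃ ≤ L·Q`, `0 ≤ λ′ ≤ L ≤ 1`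
(so `(1−L)λ′ ≤ (1−L)L ≤ ¼`).
[cite: KozmaNitzan2024, Question 8 (§5.5 p. 36)] -/
theorem kAP_level (κ L c lamp mt p₀ Bt Q : ℝ) (hκ : 0 ≤ κ) (hL0 : 0 < L) (hL1 : L ≤ 1) (hc : 0 ≤ c) (hl0 : 0 ≤ lamp)
    (hl1 : lamp ≤ L) (hmt0 : 0 ≤ mt) (hmt : mt ≤ p₀) (hp0 : 0 < p₀) (hBt0 : 0 ≤ Bt) (hBt : Bt ≤ L * Q) :
    κ * ((1 - L) * (c * lamp / L) * (mt / p₀) * Bt) ≤ 1 / 4 * κ * c * Q := by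
  have h1 : mt / p₀ ≤ 1 := by rw [div_le_one hp0]; exact hmt
  have h2 : Bt / L ≤ Q := by rw [div_le_iff₀ hL0]; linarith
  have hQ : 0 ≤ Q := le_trans (by positivity) h2
  have e : (1 - L) * (c * lamp / L) * (mt / p₀) * Bt = ((1 - L) * lamp) * c * (mt / p₀) * (Bt / L) := by
    field_simp
  rw [e]
  have h3 : (1 - L) * lamp ≤ 1 / 4 := by nlinarith [sq_nonneg (L - 1 / 2)]
  have h4 : ((1 - L) * lamp) * c * (mt / p₀) * (Bt / L) ≤ (1 / 4) * c * 1 * Q := by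
    have h1L : 0 ≤ (1 - L) * lamp := by
      have : 0 ≤ 1 - L := by linarith
      positivity
    apply mul_le_mul (mul_le_mul (mul_le_mul_of_nonneg_right h3 hc) h1 (by positivity) (by positivity)) h2
      (by positivity) (by positivity)
  nlinarith [mul_le_mul_of_nonneg_left h4 hκ]

/-- **Fuel identity, one step (exact).**  With `A = 1 − a`, `C = 1 − c`, edge weight `s`, `u_j = C(a m̃ + s u)`,
`T̃_{j−1} = T̃ + ΔT`, `ΔT = a c m̃ + s c u + s a v`, `λ_j = L·A·s`, `B̃_j = λ_j u − T̃`, `B̃_{j−1} = L u_j − T̃_{j−1}`: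
`B̃_{j−1} = (C/A)·B̃_j − c·Q + a·P` with `Q = T̃/A + a m̃ + s u`, `P = T̃/A − s v + L C m̃`.
Telescoped over an A-perfect prefix (`a = 0`, weights `κ_{j−1}`): `Σ_j κ_{j−1}c_jQ_j = κ_iB̃_i − B̃₀`.
[cite: KozmaNitzan2024, Question 8 (§5.5 p. 36)] -/
theorem kAP_star_step (L a c s u v mt Tt uj Ttp Bj Bp Q P : ℝ) (hA : 1 - a ≠ 0)
    (huj : uj = (1 - c) * (a * mt + s * u)) (hTtp : Ttp = Tt + (a * c * mt + s * c * u + s * a * v))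
    (hBj : Bj = L * (1 - a) * s * u - Tt) (hBp : Bp = L * uj - Ttp) (hQ : Q = Tt / (1 - a) + a * mt + s * u)
    (hP : P = Tt / (1 - a) - s * v + L * (1 - c) * mt) :
    Bp = (1 - c) / (1 - a) * Bj - c * Q + a * P := by
  subst huj hTtp hBj hBp hQ hP
  field_simp
  ring

/-- **`c_deep(l) ≥ (1+l)/3`, case `1 − l − l² ≤ 0`** (then `c_deep(l) = 1 − (4/3)l(1−l)`): `4l² − 5l + 2 ≥ 0`.
[cite: KozmaNitzan2024, Question 8 (§5.5 p. 36)] -/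
theorem kAP_cdeep13a (l : ℝ) : (1 + l) / 3 ≤ 1 - 4 / 3 * l * (1 - l) := by
  nlinarith [sq_nonneg (l - 5 / 8)]

/-- **`c_deep(l) ≥ (1+l)/3`, case `1 − l − l² ≥ 0`** (then `c_deep(l) = 1 − (4/3)l(1−l) − (4/3)l²(1−l−l²)/(1+l)`):
equivalent to `2 − 3l − 5l² + 8l³ + 4l⁴ ≥ 0` on `[0, 0.62]`.
[cite: KozmaNitzan2024, Question 8 (§5.5 p. 36)] -/
theorem kAP_cdeep13b (l : ℝ) (hl0 : 0 ≤ l) (hl : 0 ≤ 1 - l - l ^ 2) :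
    (1 + l) / 3 ≤ 1 - 4 / 3 * l * (1 - l) - 4 / 3 * l ^ 2 * (1 - l - l ^ 2) / (1 + l) := by
  have h1l : (0:ℝ) < 1 + l := by linarith
  have key : 0 ≤ 2 - 3 * l - 5 * l ^ 2 + 8 * l ^ 3 + 4 * l ^ 4 := by
    -- l ≤ 0.62 here; 2 - 3l - 5l² + 8l³ + 4l⁴ ≥ 0.5 roughly
    have hl1 : l ≤ 62 / 100 := by nlinarith
    nlinarith [sq_nonneg (l - 1 / 2), mul_nonneg hl0 (sq_nonneg (l - 1 / 2)), mul_nonneg hl0 hl,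
      mul_nonneg (mul_nonneg hl0 hl0) (sq_nonneg (l - 1/2)), pow_nonneg hl0 3, pow_nonneg hl0 4]
  rw [div_le_iff₀ (by norm_num : (0:ℝ) < 3)] at *
  have e : (1 - 4 / 3 * l * (1 - l) - 4 / 3 * l ^ 2 * (1 - l - l ^ 2) / (1 + l)) * 3
      = (3 * (1 + l) - 4 * l * (1 - l) * (1 + l) - 4 * l ^ 2 * (1 - l - l ^ 2)) / (1 + l) := by
    field_simp
  rw [e, le_div_iff₀ h1l]
  nlinarith [key]

/-- **Assembly (A-perfect prefix, any `i`).**  `PRE − CR ≤ ΣκC1 ≤ ¼(κ_iB̃_i − B̃₀)`, `B̃₀ ≥ 0`, `(1+λ_i)/3 ≤ c_deep(λ_i)` give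
`PRE − CR ≤ c_deep(λ_i)·BUD_i` with `BUD_i = ¾κ_iB̃_i/(1+λ_i)`.
[cite: KozmaNitzan2024, Question 8 (§5.5 p. 36)] -/
theorem kAP_final (D S X B₀ l cd : ℝ) (h1 : D ≤ S) (h2 : S ≤ 1 / 4 * (X - B₀)) (hB0 : 0 ≤ B₀) (hX : 0 ≤ X)
    (hl : 0 ≤ l) (hcd : (1 + l) / 3 ≤ cd) :
    D ≤ cd * (3 / 4 * X / (1 + l)) := by
  have h1l : (0:ℝ) < 1 + l := by linarith
  have h3 : D ≤ 1 / 4 * X := by linarith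
  have h4 : 1 / 4 * X ≤ cd * (3 / 4 * X / (1 + l)) := by
    rw [show cd * (3 / 4 * X / (1 + l)) = (cd * (3 / 4 * X)) / (1 + l) by ring, le_div_iff₀ h1l]
    have : (1 + l) / 3 * (3 / 4 * X) ≤ cd * (3 / 4 * X) := mul_le_mul_of_nonneg_right hcd (by positivity)
    nlinarith
  linarith

end PocketCert

end Summit.CriticalPhenomena.PercolationContinuityZ3.Theorems
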